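import Literature.Analysis.FluidPDE.CompressibleEulerImplosionODEContinuation
import HarnessLib

/-!
# Buckmaster–Cao-Labora–Gómez-Serrano: time reversal, backward continuation, endpoint uniqueness

Topic `Literature/Analysis/FluidPDE`; namespace
`Literature.Analysis.FluidPDE.BuckmasterCaolaboraGomezserrano2025.ODE`. Sequel of
`CompressibleEulerImplosionODEContinuation.lean` (uniqueness on open intervals, uniform existence
time, extension, global forward existence under confinement), companion of
`CompressibleEulerImplosion.lean` (named fact `BuckmasterCaolaboraGomezserrano2025_thm11_monatomic`,
THEOREM 1.1 of T. Buckmaster, G. Cao-Labora, J. Gómez-Serrano, *Smooth imploding solutions for 3D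
compressible fluids*, Forum Math. Pi 13 (2025) e6, arXiv:2208.09445).

Brick A-ext part 2 of the discharge plan (the remaining standard ODE theory behind Proposition 1.6,
which is stated for BOTH ends `ξ → ξ₁⁺`, `ξ → ξ₂⁻` of the maximal interval, and behind the barrier
arguments run backwards in `ξ` to the right of `P_s`, §4): the time-reversed curve solves the
reversed field (`hasDerivAt_reverse`), global BACKWARD existence under confinement
(`exists_forall_hasDerivAt_of_confined_backward`), and uniqueness from an initial/terminal time
(`eqOn_Ico_of_contDiffAt`, `eqOn_Ioc_of_contDiffAt`). Theorems only, folklore.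
[cite: BuckmasterCaolaboraGomezserrano2025, Prop. 1.6, §9.1]
-/

noncomputable section

open Set Filter Metric Topology

namespace Literature.Analysis.FluidPDE

namespace BuckmasterCaolaboraGomezserrano2025

namespace ODE

variable {E : Type*} [NormedAddCommGroup E] [NormedSpace ℝ E] {F : E → E} {U : Set E}

/-! ### Time reversal -/

/-- **Time reversal**: if `c` solves `c′ = F(c)` at `−s` then `s ↦ c(−s)` solves the reversed
field `−F` at `s`. [folklore] -/
theorem hasDerivAt_reverse {c : ℝ → E} {s : ℝ} (hc : HasDerivAt c (F (c (-s))) (-s)) :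
    HasDerivAt (fun s => c (-s)) (-F (c (-s))) s := by
  have h := hc.scomp s (hasDerivAt_neg s)
  simp only [neg_smul, one_smul] at h
  exact h

/-! ### Global backward existence under confinement -/

/-- **Global backward existence under confinement**: let `F` be `C¹` at the points of `U`,
`K ⊆ U` compact, `x₀ ∈ K`. If every solution arriving at `x₀` at time `t₀` stays in `K` on `(T, t₀]`
whenever it is defined on `(T, t₀]`, then there is a solution arriving at `x₀` at time `t₀` defined
for all `t < t₀ + δ` (some `δ > 0`), in particular for all `t ≤ t₀`.
[cite: BuckmasterCaolaboraGomezserrano2025, Prop. 1.6] -/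
theorem exists_forall_hasDerivAt_of_confined_backward [CompleteSpace E]
    (hF : ∀ x ∈ U, ContDiffAt ℝ 1 F x) {K : Set E} (hK : IsCompact K) (hKU : K ⊆ U) {x₀ : E}
    (hx₀ : x₀ ∈ K) (t₀ : ℝ)
    (hconf : ∀ (c : ℝ → E) (T : ℝ), c t₀ = x₀ → (∀ t ∈ Ioc T t₀, HasDerivAt c (F (c t)) t) →
      ∀ t ∈ Ioc T t₀, c t ∈ K) :
    ∃ c : ℝ → E, ∃ δ > (0 : ℝ), c t₀ = x₀ ∧ ∀ t, t < t₀ + δ → HasDerivAt c (F (c t)) t := by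
  -- apply the forward theorem to the reversed field `G = -F` at time `-t₀`
  have hG : ∀ x ∈ U, ContDiffAt ℝ 1 (fun x => -F x) x := fun x hx => (hF x hx).neg
  have hconf' : ∀ (d : ℝ → E) (T : ℝ), d (-t₀) = x₀ →
      (∀ s ∈ Ico (-t₀) T, HasDerivAt d ((fun x => -F x) (d s)) s) → ∀ s ∈ Ico (-t₀) T, d s ∈ K := by
    intro d T hd0 hd s hs
    -- the curve `c t = d (-t)` solves `F` on `Ioc (-T) t₀`
    have hc : ∀ t ∈ Ioc (-T) t₀, HasDerivAt (fun t => d (-t)) (F (d (-t))) t := by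
      intro t ht
      have h := hd (-t) ⟨by linarith [ht.2], by linarith [ht.1]⟩
      have := hasDerivAt_reverse (F := fun x => -F x) (c := d) (s := t) (by simpa using h)
      simpa using this
    have := hconf (fun t => d (-t)) (-T) (by simpa using hd0) hc (-s) ⟨by linarith [hs.2], by linarith [hs.1]⟩
    simpa using this
  obtain ⟨d, δ, hδ, hd0, hd⟩ :=
    exists_forall_hasDerivAt_of_confined hG hK hKU hx₀ (-t₀) hconf'
  refine ⟨fun t => d (-t), δ, hδ, by simpa using hd0, fun t ht => ?_⟩
  have h := hd (-t) (by linarith)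
  have := hasDerivAt_reverse (F := fun x => -F x) (c := d) (s := t) (by simpa using h)
  simpa using this

/-! ### Uniqueness from an endpoint -/

/-- **Uniqueness from the initial time**: two solutions on `[t₀, b)` (with derivatives at every
point of `[t₀, b)`), along the first of which `F` is `C¹`, agreeing at `t₀`, agree on `[t₀, b)`.
[folklore] -/
theorem eqOn_Ico_of_contDiffAt {c₁ c₂ : ℝ → E} {t₀ b : ℝ}
    (hF : ∀ t ∈ Ico t₀ b, ContDiffAt ℝ 1 F (c₁ t))
    (h₁ : ∀ t ∈ Ico t₀ b, HasDerivAt c₁ (F (c₁ t)) t)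
    (h₂ : ∀ t ∈ Ico t₀ b, HasDerivAt c₂ (F (c₂ t)) t)
    (heq : c₁ t₀ = c₂ t₀) : EqOn c₁ c₂ (Ico t₀ b) := by
  rcases le_or_gt b t₀ with hb | hb
  · intro t ht; exact absurd (ht.1.trans_lt ht.2) (not_lt.mpr hb)
  have ht₀ : t₀ ∈ Ico t₀ b := ⟨le_rfl, hb⟩
  obtain ⟨K, S, hS, hK⟩ := (hF t₀ ht₀).exists_lipschitzOnWith
  -- both curves stay in `S` for a short time after `t₀`
  have hc₁ : ContinuousAt c₁ t₀ := (h₁ t₀ ht₀).continuousAt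
  have hc₂ : ContinuousAt c₂ t₀ := (h₂ t₀ ht₀).continuousAt
  have hm₁ : ∀ᶠ t in 𝓝 t₀, c₁ t ∈ S := hc₁.preimage_mem_nhds hS
  have hm₂ : ∀ᶠ t in 𝓝 t₀, c₂ t ∈ S := hc₂.preimage_mem_nhds (by rw [← heq]; exact hS)
  have hm : ∀ᶠ t in 𝓝 t₀, c₁ t ∈ S ∧ c₂ t ∈ S := hm₁.and hm₂
  obtain ⟨ε, hε, hεS⟩ : ∃ ε > (0 : ℝ), ∀ t, dist t t₀ < ε → c₁ t ∈ S ∧ c₂ t ∈ S :=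
    Metric.eventually_nhds_iff.mp hm
  -- a short closed interval `[t₀, t₀ + η] ⊆ [t₀, b)` inside the `ε`-ball
  set η : ℝ := min (ε / 2) ((b - t₀) / 2) with hη
  have hη0 : 0 < η := lt_min (by linarith) (by linarith)
  have hηε : η < ε := lt_of_le_of_lt (min_le_left _ _) (by linarith)
  have hηb : t₀ + η < b := by
    have := min_le_right (ε / 2) ((b - t₀) / 2); linarith
  have hsub : Icc t₀ (t₀ + η) ⊆ Ico t₀ b := fun t ht => ⟨ht.1, lt_of_le_of_lt ht.2 hηb⟩
  have hdist : ∀ t ∈ Ico t₀ (t₀ + η), dist t t₀ < ε := fun t ht => by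
    rw [Real.dist_eq, abs_of_nonneg (by linarith [ht.1])]; linarith [ht.2]
  have hshort : EqOn c₁ c₂ (Icc t₀ (t₀ + η)) :=
    ODE_solution_unique_of_mem_Icc_right (v := fun _ => F) (s := fun _ => S) (K := K)
      (fun _ _ => hK)
      (fun t ht => (h₁ t (hsub ht)).continuousAt.continuousWithinAt)
      (fun t ht => (h₁ t (hsub (Ico_subset_Icc_self ht))).hasDerivWithinAt)
      (fun t ht => (hεS t (hdist t ht)).1)
      (fun t ht => (h₂ t (hsub ht)).continuousAt.continuousWithinAt)
      (fun t ht => (h₂ t (hsub (Ico_subset_Icc_self ht))).hasDerivWithinAt)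
      (fun t ht => (hεS t (hdist t ht)).2) heq
  -- propagate along the open interval `(t₀, b)` from the interior point `t₀ + η/2`
  have hlong : EqOn c₁ c₂ (Ioo t₀ b) :=
    eqOn_of_contDiffAt (t₀ := t₀ + η / 2) ⟨by linarith, by linarith⟩
      (fun t ht => hF t ⟨ht.1.le, ht.2⟩) (fun t ht => h₁ t ⟨ht.1.le, ht.2⟩)
      (fun t ht => h₂ t ⟨ht.1.le, ht.2⟩) (hshort ⟨by linarith, by linarith⟩)
  intro t ht
  rcases eq_or_lt_of_le ht.1 with h | h
  · subst h; exact heq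
  · exact hlong ⟨h, ht.2⟩

/-- **Uniqueness from the terminal time**: two solutions on `(a, t₀]`, along the first of which
`F` is `C¹`, agreeing at `t₀`, agree on `(a, t₀]`. [folklore] -/
theorem eqOn_Ioc_of_contDiffAt {c₁ c₂ : ℝ → E} {a t₀ : ℝ}
    (hF : ∀ t ∈ Ioc a t₀, ContDiffAt ℝ 1 F (c₁ t))
    (h₁ : ∀ t ∈ Ioc a t₀, HasDerivAt c₁ (F (c₁ t)) t)
    (h₂ : ∀ t ∈ Ioc a t₀, HasDerivAt c₂ (F (c₂ t)) t)
    (heq : c₁ t₀ = c₂ t₀) : EqOn c₁ c₂ (Ioc a t₀) := by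
  -- reverse time and use the initial-time version for the field `-F`
  have h := eqOn_Ico_of_contDiffAt (F := fun x => -F x) (c₁ := fun s => c₁ (-s))
    (c₂ := fun s => c₂ (-s)) (t₀ := -t₀) (b := -a)
    (fun s hs => (hF (-s) ⟨by linarith [hs.2], by linarith [hs.1]⟩).neg)
    (fun s hs => hasDerivAt_reverse (h₁ (-s) ⟨by linarith [hs.2], by linarith [hs.1]⟩))
    (fun s hs => hasDerivAt_reverse (h₂ (-s) ⟨by linarith [hs.2], by linarith [hs.1]⟩))
    (by simpa using heq)
  intro t ht
  have := h (x := -t) ⟨by linarith [ht.2], by linarith [ht.1]⟩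
  simpa using this

end ODE

end BuckmasterCaolaboraGomezserrano2025

end Literature.Analysis.FluidPDE
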